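/-
Copyright (c) 2026. All rights reserved.
Released under Apache 2.0 license as described in the file LICENSE.
Authors: abc-iut cell, wave-2 seat abc-iut-L3-t11 (proof-only; G10 rung 3b: [SemiAnbd] Thm 3.7 (iii) second
part assembled modulo the level data of the chart, parallel to abc-iut-L3-t6's conj-1 skeleton).
-/
import Literature.AnabelianGeometry.SemiGraphs.TemperedMaximalCompact
import Literature.AnabelianGeometry.SemiGraphs.TreeSystemFixedPair
import HarnessLib

/-!
# [SemiAnbd] Theorem 3.7 (iii), second part: the assembly modulo the level data of the chart

Mochizuki, *Semi-graphs of anabelioids*, Publ. RIMS **42** (2006) [MochizukiSemiAnbd2006], Thm 3.7 (iii)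
p. 40–41 and its proof p. 41 (PRIMS pp. 265–266): "If a nontrivial compact subgroup of `π₁^temp(G)` is
contained in more than one verticial subgroup, then it is contained in precisely two verticial subgroups,
determined by a compatible system of pairs of vertices of the `G_{∞,i}` joined to one another by a single
[closed] edge. In particular … this compact subgroup is contained in [an edge-like subgroup]."

This PROOF-ONLY file assembles that statement — the SECOND conjunct of abc-iut-L3-t2's
`ProfiniteSemiGraph.CompactInVerticial` — for an arbitrary chart `c : TemperedPiChart 𝒢`, modulo the LEVEL
DATA of the chart stated as explicit hypotheses (to be supplied by rung 1, the construction of Prop 3.6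
(i)(ii), abc-iut-L3-t9), in the same style as abc-iut-L3-t6's `compactInVerticial_conj1_of_levelData`:
a directed system of TREES `T j` (the `G_{∞,j}`) over `𝔾 = 𝒢.graph` with transition MORPHISMS `f`,
actions `ρ j : c.G →* Aut (T j)`, and three identifications — (I1) every verticial subgroup fixes a
compatible system of tree vertices, (I2) the pointwise stabiliser of a compatible system of tree vertices
lies in a verticial subgroup, (I3) the pointwise stabiliser of an (eventual) compatible system of tree
EDGES lies in an edge-like subgroup of the image edge — together with the output `htwo` of the
estrangement step of the printed proof ("for all large `j`, `C` fixes at most two vertices of `G_{∞,j}`",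
obtained there from total estrangement through the finite levels and Rmk 2.2.1) and Thm 3.7 (ii)
(`VerticialDistinct`, for "nested verticial subgroups are equal", `TemperedMaximalCompact.lean`).
Everything else is the tree-system combinatorics of `TreeSystemFixedPair.lean` /
`TreeFixedPairProofs.lean` (Lemma 1.8 (ii)(b)).

* `compactInVerticial_conj2_of_levelData` — the second conjunct of `CompactInVerticial` for `c` and a
  compact `C` lying in two distinct verticial subgroups: only those two contain `C`, and `C` lies in an
  edge-like subgroup of a CLOSED edge.
-/

namespace Literature.AnabelianGeometry.SemiGraphs

namespace ProfiniteSemiGraph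

open CategoryTheory Topology

universe u v

variable {𝒢 : ProfiniteSemiGraph.{u}}

/-- **Theorem 3.7 (iii), second part, modulo the level data of the chart** (p. 41). Data: trees `T j`
over `𝒢.graph` (`p j`), transition morphisms `f`, actions `ρ j` of `c.G`; identifications (I1) `hfix`,
(I2) `hstab`, (I3) `hedge`; the estrangement output `htwo` for the compact subgroup `C`; Thm 3.7 (ii).
Conclusion: if `C` lies in two distinct verticial subgroups `H₁`, `H₂`, then every verticial subgroup
containing `C` is `H₁` or `H₂`, and `C` lies in an edge-like subgroup of a closed edge.
[cite: MochizukiSemiAnbd2006, Thm. 3.7(iii) p.41] -/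
theorem compactInVerticial_conj2_of_levelData (hVD : VerticialDistinct.{u}) (h𝒢 : 𝒢.Thm37Hypotheses)
    (c : TemperedPiChart 𝒢)
    {J : Type v} [Preorder J] [IsDirectedOrder J] (T : J → SemiGraph.{u}) (hT : ∀ j, (T j).IsTree)
    (p : ∀ j, T j ⟶ 𝒢.graph) (ρ : ∀ j, c.G →* Aut (T j))
    (f : ∀ ⦃i j : J⦄, i ≤ j → (T j ⟶ T i))
    (hfix : ∀ (v : 𝒢.graph.Vertex) (H : Subgroup c.G), H ∈ verticialSubgroups c v →
      ∃ x : ∀ j, (T j).Vertex, (∀ ⦃i j : J⦄ (h : i ≤ j), (f h).vertexMap (x j) = x i) ∧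
        ∀ g ∈ H, ∀ j, (ρ j g).hom.vertexMap (x j) = x j)
    (hstab : ∀ x : ∀ j, (T j).Vertex, (∀ ⦃i j : J⦄ (h : i ≤ j), (f h).vertexMap (x j) = x i) →
      ∃ (v : 𝒢.graph.Vertex) (H : Subgroup c.G), H ∈ verticialSubgroups c v ∧
        ∀ g : c.G, (∀ j, (ρ j g).hom.vertexMap (x j) = x j) → g ∈ H)
    (hedge : ∀ (j₁ : J) (ε : ∀ j : {j : J // j₁ ≤ j}, (T j.1).Edge),
      (∀ ⦃i j : {j : J // j₁ ≤ j}⦄ (h : i.1 ≤ j.1), (f h).edgeMap (ε j) = ε i) →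
      ∃ (e : 𝒢.graph.Edge) (L : Subgroup c.G), L ∈ edgeLikeSubgroups c e ∧
        (∀ j, (p j.1).edgeMap (ε j) = e) ∧
        ∀ g : c.G, (∀ j, (ρ j.1 g).hom.edgeMap (ε j) = ε j ∧
          ∀ b : (T j.1).Branch, (T j.1).edgeOf b = ε j → (ρ j.1 g).hom.branchMap b = b) → g ∈ L)
    (C : Subgroup c.G)
    (htwo : ∃ j₀ : J, ∀ j, j₀ ≤ j → ∀ a b d : (T j).Vertex,
      (∀ γ : C, (ρ j γ).hom.vertexMap a = a) → (∀ γ : C, (ρ j γ).hom.vertexMap b = b) →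
      (∀ γ : C, (ρ j γ).hom.vertexMap d = d) → a = b ∨ b = d ∨ a = d)
    {v₁ v₂ : 𝒢.graph.Vertex} {H₁ H₂ : Subgroup c.G} (hH₁ : H₁ ∈ verticialSubgroups c v₁)
    (hH₂ : H₂ ∈ verticialSubgroups c v₂) (hne : H₁ ≠ H₂) (hC₁ : C ≤ H₁) (hC₂ : C ≤ H₂) :
    (∀ (v₃ : 𝒢.graph.Vertex) (H₃ : Subgroup c.G), H₃ ∈ verticialSubgroups c v₃ → C ≤ H₃ →
        H₃ = H₁ ∨ H₃ = H₂) ∧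
      ∃ (e : 𝒢.graph.Edge) (L : Subgroup c.G), 𝒢.graph.IsClosedEdge e ∧
        L ∈ edgeLikeSubgroups c e ∧ C ≤ L := by
  classical
  -- the restricted actions of `C`
  let ρC : ∀ j, C →* Aut (T j) := fun j => (ρ j).comp C.subtype
  have ρC_apply : ∀ (j : J) (γ : C), ρC j γ = ρ j γ := fun _ _ => rfl
  obtain ⟨j₀, hj₀⟩ := htwo
  -- (I1): the two verticial subgroups fix compatible systems `x₁`, `x₂`, hence so does `C`
  obtain ⟨x₁, hx₁c, hx₁f⟩ := hfix v₁ H₁ hH₁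
  obtain ⟨x₂, hx₂c, hx₂f⟩ := hfix v₂ H₂ hH₂
  have hx₁C : ∀ (j : J) (γ : C), (ρC j γ).hom.vertexMap (x₁ j) = x₁ j :=
    fun j γ => hx₁f γ (hC₁ γ.2) j
  have hx₂C : ∀ (j : J) (γ : C), (ρC j γ).hom.vertexMap (x₂ j) = x₂ j :=
    fun j γ => hx₂f γ (hC₂ γ.2) j
  -- two verticial subgroups fixing the SAME system coincide (via (I2) and Thm 3.7 (ii))
  have same : ∀ {w w' : 𝒢.graph.Vertex} {K K' : Subgroup c.G}, K ∈ verticialSubgroups c w →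
      K' ∈ verticialSubgroups c w' → ∀ x : ∀ j, (T j).Vertex,
      (∀ ⦃i j : J⦄ (h : i ≤ j), (f h).vertexMap (x j) = x i) →
      (∀ g ∈ K, ∀ j, (ρ j g).hom.vertexMap (x j) = x j) →
      (∀ g ∈ K', ∀ j, (ρ j g).hom.vertexMap (x j) = x j) → K = K' := by
    intro w w' K K' hK hK' x hxc hKx hK'x
    obtain ⟨v', H', hH', hstabx⟩ := hstab x hxc
    have h1 : K = H' := eq_of_le_of_mem_verticialSubgroups hVD h𝒢 c hK hH' fun g hg => hstabx g (hKx g hg)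
    have h2 : K' = H' := eq_of_le_of_mem_verticialSubgroups hVD h𝒢 c hK' hH' fun g hg => hstabx g (hK'x g hg)
    rw [h1, h2]
  -- hence `x₁ ≠ x₂`, at some level `i`
  have hx₁₂ : ∃ i, x₁ i ≠ x₂ i := by
    by_contra hall
    push Not at hall
    have : x₁ = x₂ := funext hall
    subst this
    exact hne (same hH₁ hH₂ x₁ hx₁c hx₁f hx₂f)
  obtain ⟨i, hi⟩ := hx₁₂
  -- the `htwo` hypothesis in the form of `TreeSystemFixedPair`
  have htwo' : ∀ j, j₀ ≤ j → ∀ a b d : (T j).Vertex, (∀ γ, (ρC j γ).hom.vertexMap a = a) →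
      (∀ γ, (ρC j γ).hom.vertexMap b = b) → (∀ γ, (ρC j γ).hom.vertexMap d = d) → a = b ∨ b = d ∨ a = d :=
    fun j hj a b d ha hb hd => hj₀ j hj a b d ha hb hd
  refine ⟨fun v₃ H₃ hH₃ hC₃ => ?_, ?_⟩
  · -- ONLY TWO: a third verticial subgroup containing `C` fixes a third system, which must be `x₁` or `x₂`
    obtain ⟨x₃, hx₃c, hx₃f⟩ := hfix v₃ H₃ hH₃
    have hx₃C : ∀ (j : J) (γ : C), (ρC j γ).hom.vertexMap (x₃ j) = x₃ j :=
      fun j γ => hx₃f γ (hC₃ γ.2) j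
    by_cases h31 : ∃ i₁, x₃ i₁ ≠ x₁ i₁
    · by_cases h32 : ∃ i₂, x₃ i₂ ≠ x₂ i₂
      · obtain ⟨i₁, hi₁⟩ := h31
        obtain ⟨i₂, hi₂⟩ := h32
        exact (SemiGraph.atMostTwo_compatible_fixed_systems T ρC (fun i j h => (f h).vertexMap) j₀ htwo'
          hx₃c hx₁c hx₂c hx₃C hx₁C hx₂C hi₁ hi hi₂).elim
      · push Not at h32
        have : x₃ = x₂ := funext h32
        subst this
        exact Or.inr (same hH₃ hH₂ x₃ hx₃c hx₃f hx₂f)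
    · push Not at h31
      have : x₃ = x₁ := funext h31
      subst this
      exact Or.inl (same hH₃ hH₁ x₃ hx₃c hx₃f hx₁f)
  · -- THE EDGE: at every level `j ≥ j₀, i` the fixed pair is joined by a unique closed edge, fixed with
    -- its branches; these edges form a compatible system above a common bound `j₁`
    obtain ⟨j₁, hj₁₀, hj₁i⟩ := exists_ge_ge j₀ i
    have adj : ∀ j : {j : J // j₁ ≤ j}, ∃ (e : (T j.1).Edge) (b b' : (T j.1).Branch),
        (T j.1).IsClosedEdge e ∧ b ≠ b' ∧ (T j.1).edgeOf b = e ∧ (T j.1).edgeOf b' = e ∧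
        (T j.1).abuts b = some (x₁ j.1) ∧ (T j.1).abuts b' = some (x₂ j.1) ∧
        ∀ γ : C, (ρC j.1 γ).hom.edgeMap e = e ∧
          ∀ b'' : (T j.1).Branch, (T j.1).edgeOf b'' = e → (ρC j.1 γ).hom.branchMap b'' = b'' :=
      fun j => SemiGraph.adjacent_of_compatible_fixed_systems T ρC (fun i j h => (f h).vertexMap) hT j₀
        htwo' hx₁c hx₂c hx₁C hx₂C hi (hj₁₀.trans j.2) (hj₁i.trans j.2)
    choose ε bε bε' hεcl hbb hbε hb'ε hbx hb'x hεfix using adj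
    -- compatibility of the edges, by uniqueness of the edge joining `x₁ i'` and `x₂ i'` (`i' ≥ i`)
    have hεc : ∀ ⦃i' j : {j : J // j₁ ≤ j}⦄ (h : i'.1 ≤ j.1), (f h).edgeMap (ε j) = ε i' := by
      intro i' j h
      have hx12 : x₁ i'.1 ≠ x₂ i'.1 :=
        SemiGraph.ne_of_compatible_ne T (fun i j h => (f h).vertexMap) hx₁c hx₂c hi (hj₁i.trans i'.2)
      -- the image of `ε j` has branches at `x₁ i'` and `x₂ i'`
      refine SemiGraph.edge_unique_of_abuts (hT i'.1) hx12 (c := (f h).branchMap (bε j))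
        (d := (f h).branchMap (bε' j)) (c' := bε i') (d' := bε' i') ?_ ?_ (hbε i') (hb'ε i') ?_ ?_
        (hbx i') (hb'x i')
      · rw [(f h).edgeOf_branchMap, hbε j]
      · rw [(f h).edgeOf_branchMap, hb'ε j]
      · rw [(f h).abuts_branchMap _ _ (hbx j), hx₁c h]
      · rw [(f h).abuts_branchMap _ _ (hb'x j), hx₂c h]
    -- (I3): the stabiliser of the edge system lies in an edge-like subgroup `L` of the image edge `e`
    obtain ⟨e, L, hL, hpe, hLstab⟩ := hedge j₁ ε hεc
    refine ⟨e, L, ?_, hL, fun g hg => hLstab g fun j => hεfix j ⟨g, hg⟩⟩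
    -- `e` is closed: the image of the closed edge `ε j₁` with its two distinct abutting branches
    let jj : {j : J // j₁ ≤ j} := ⟨j₁, le_rfl⟩
    rw [← hpe jj]
    refine SemiGraph.isClosedEdge_of_abuts (c := (p jj.1).branchMap (bε jj)) (c' := (p jj.1).branchMap (bε' jj))
      (fun heq => hbb jj ((p jj.1).branchMap_injOn _ _ (by rw [hbε jj, hb'ε jj]) heq)) ?_ ?_
      ((p jj.1).abuts_branchMap _ _ (hbx jj)) ((p jj.1).abuts_branchMap _ _ (hb'x jj))
    · rw [(p jj.1).edgeOf_branchMap, hbε jj]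
    · rw [(p jj.1).edgeOf_branchMap, hb'ε jj]

end ProfiniteSemiGraph

end Literature.AnabelianGeometry.SemiGraphs
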